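import Mathlib.Analysis.SpecialFunctions.Trigonometric.Basic
import Literature.Topology.FourManifolds.PlanarArch
import Literature.Topology.FourManifolds.CreaseProfile
import HarnessLib

/-!
# The derivative of `Real.smoothTransition`: closed form and flat ends; fast phases

Sibling of `PlanarArch.lean` (`hasDerivAt_expNegInvGlue`, `deriv_smoothTransition_pos`,
`strictMonoOn_smoothTransition`) and `CreaseProfile.lean` (`smoothTransition_add_one_sub`), which
are reused.  Mathlib's standard smooth step `S = Real.smoothTransition`
(`S x = g x / (g x + g (1 - x))`, `g = expNegInvGlue`, `g x = e^{-1/x}` for `x > 0`) comes with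
`S = 0` on `(-∞, 0]`, `S = 1` on `[1, ∞)`, `0 < S < 1` on `(0, 1)`, monotonicity and smoothness,
but without a closed form for its derivative.  PROVED here:

* `hasDerivAt_smoothTransition`, `deriv_smoothTransition_eq` — on `(0, 1)`,
  **`S' = S (1 - S) (1/x² + 1/(1 - x)²)`** (logistic-type closed form); `smoothTransition_half`;
* the FLAT-END estimates `smoothTransition_le_sq_mul_deriv` (`S x ≤ 2x² S' x` on `(0, 1/2]`) and
  `one_sub_smoothTransition_le_sq_mul_deriv` (`1 - S x ≤ 2(1 - x)² S' x` on `[1/2, 1)`): where the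
  step is slow it is also exponentially close to its end values;
* their consequence `smoothTransition_fastPhase`: **a fast smooth-step phase crosses a slow target
  transversally and only where it is fast** — for `k ≥ k₁(w, m₀, M)` every solution `x ∈ [-w, w]` of
  `2πk S((x + w)/2w) + g x ∈ 2πℤ`, where `|g'| ≤ M` and `g` stays `m₀`-away from `2πℤ`, has
  `d/dx (2πk S((x + w)/2w) + g x) > 0` (used to count the crossings created by `k` full twists
  inserted across a band of half-width `w`, `Literature/Topology/FourManifolds/MMSWStripTwist.lean`).

[folklore]

## References

* Mathlib `Real.smoothTransition`, `expNegInvGlue` (definitions and qualitative properties).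
* L. Hörmander, *The Analysis of Linear Partial Differential Operators I*, 2nd ed. (1990), §1.4
  (the functions `e^{-1/x}` and smooth partitions). [folklore]
-/

noncomputable section

open Real Set Filter
open scoped Topology

namespace Literature.Topology.FourManifolds

/-! ## The derivative of `smoothTransition` in closed form -/

/-- **The derivative of the smooth step on `(0, 1)`**:
`S' x = S x · (1 - S x) · (1/x² + 1/(1 - x)²)`. [folklore] -/
theorem hasDerivAt_smoothTransition {x : ℝ} (hx0 : 0 < x) (hx1 : x < 1) :
    HasDerivAt smoothTransition
      (smoothTransition x * (1 - smoothTransition x) * ((x ^ 2)⁻¹ + ((1 - x) ^ 2)⁻¹)) x := by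
  have ha : HasDerivAt expNegInvGlue ((x ^ 2)⁻¹ * expNegInvGlue x) x := hasDerivAt_expNegInvGlue x
  have hb0 : HasDerivAt expNegInvGlue (((1 - x) ^ 2)⁻¹ * expNegInvGlue (1 - x)) (1 - x) :=
    hasDerivAt_expNegInvGlue (1 - x)
  have hb : HasDerivAt (fun y ↦ expNegInvGlue (1 - y))
      (((1 - x) ^ 2)⁻¹ * expNegInvGlue (1 - x) * (-1)) x := by
    have h := hb0.comp x ((hasDerivAt_id x).const_sub 1)
    simpa [Function.comp_def] using h
  have hden : expNegInvGlue x + expNegInvGlue (1 - x) ≠ 0 := (smoothTransition.pos_denom x).ne'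
  have hq : HasDerivAt (fun y ↦ expNegInvGlue y / (expNegInvGlue y + expNegInvGlue (1 - y)))
      (((x ^ 2)⁻¹ * expNegInvGlue x * (expNegInvGlue x + expNegInvGlue (1 - x)) -
        expNegInvGlue x * ((x ^ 2)⁻¹ * expNegInvGlue x +
          ((1 - x) ^ 2)⁻¹ * expNegInvGlue (1 - x) * (-1))) /
        (expNegInvGlue x + expNegInvGlue (1 - x)) ^ 2) x :=
    ha.div (ha.add hb) hden
  have hS : smoothTransition = fun y ↦ expNegInvGlue y / (expNegInvGlue y + expNegInvGlue (1 - y)) :=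
    rfl
  have hSx : smoothTransition x = expNegInvGlue x / (expNegInvGlue x + expNegInvGlue (1 - x)) := rfl
  rw [hSx, hS]
  refine hq.congr_deriv ?_
  have hx0' : x ≠ 0 := hx0.ne'
  have hx1' : 1 - x ≠ 0 := by linarith [hx1]
  field_simp
  ring

/-- The derivative of the smooth step on `(0, 1)`, `deriv` form. [folklore] -/
theorem deriv_smoothTransition_eq {x : ℝ} (hx0 : 0 < x) (hx1 : x < 1) :
    deriv smoothTransition x =
      smoothTransition x * (1 - smoothTransition x) * ((x ^ 2)⁻¹ + ((1 - x) ^ 2)⁻¹) :=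
  (hasDerivAt_smoothTransition hx0 hx1).deriv

/-- `S (1/2) = 1/2`. [folklore] -/
theorem smoothTransition_half : smoothTransition (1 / 2) = 1 / 2 := by
  have h := smoothTransition_add_one_sub (1 / 2)
  norm_num at h
  linarith

/-- On `[0, 1/2]` the smooth step is at most `1/2`. [folklore] -/
theorem smoothTransition_le_half {x : ℝ} (hx : x ≤ 1 / 2) : smoothTransition x ≤ 1 / 2 := by
  rw [← smoothTransition_half]
  exact smoothTransition.monotone hx

/-- On `[1/2, 1]` the smooth step is at least `1/2`. [folklore] -/
theorem half_le_smoothTransition {x : ℝ} (hx : 1 / 2 ≤ x) : 1 / 2 ≤ smoothTransition x := by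
  rw [← smoothTransition_half]
  exact smoothTransition.monotone hx

/-! ## Flat ends: where the step is slow it is close to its end values -/

/-- **Left flat end**: `S x ≤ 2 x² S' x` for `0 < x ≤ 1/2`. [folklore] -/
theorem smoothTransition_le_sq_mul_deriv {x : ℝ} (hx0 : 0 < x) (hx : x ≤ 1 / 2) :
    smoothTransition x ≤ 2 * x ^ 2 * deriv smoothTransition x := by
  have hx1 : x < 1 := by linarith
  rw [deriv_smoothTransition_eq hx0 hx1]
  have hS0 := (smoothTransition.pos_of_pos hx0).le
  have hS1 : 1 / 2 ≤ 1 - smoothTransition x := by linarith [smoothTransition_le_half hx]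
  have h1x : 0 < 1 - x := by linarith
  -- `2x² · S(1-S)(x⁻² + (1-x)⁻²) ≥ 2x² · S · (1/2) · x⁻² = S`
  have hinv : (x ^ 2)⁻¹ ≤ (x ^ 2)⁻¹ + ((1 - x) ^ 2)⁻¹ := le_add_of_nonneg_right (by positivity)
  calc smoothTransition x = 2 * x ^ 2 * (smoothTransition x * (1 / 2) * (x ^ 2)⁻¹) := by
        field_simp
    _ ≤ 2 * x ^ 2 * (smoothTransition x * (1 - smoothTransition x) *
          ((x ^ 2)⁻¹ + ((1 - x) ^ 2)⁻¹)) := by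
        gcongr

/-- **Right flat end**: `1 - S x ≤ 2 (1 - x)² S' x` for `1/2 ≤ x < 1`. [folklore] -/
theorem one_sub_smoothTransition_le_sq_mul_deriv {x : ℝ} (hx : 1 / 2 ≤ x) (hx1 : x < 1) :
    1 - smoothTransition x ≤ 2 * (1 - x) ^ 2 * deriv smoothTransition x := by
  have hx0 : 0 < x := by linarith
  rw [deriv_smoothTransition_eq hx0 hx1]
  have hS1 : 0 ≤ 1 - smoothTransition x := by linarith [smoothTransition.le_one x]
  have hS0 : 1 / 2 ≤ smoothTransition x := half_le_smoothTransition hx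
  have h1x : 0 < 1 - x := by linarith
  have hinv : ((1 - x) ^ 2)⁻¹ ≤ (x ^ 2)⁻¹ + ((1 - x) ^ 2)⁻¹ := le_add_of_nonneg_left (by positivity)
  calc 1 - smoothTransition x
        = 2 * (1 - x) ^ 2 * ((1 / 2) * (1 - smoothTransition x) * ((1 - x) ^ 2)⁻¹) := by
        field_simp
    _ ≤ 2 * (1 - x) ^ 2 * (smoothTransition x * (1 - smoothTransition x) *
          ((x ^ 2)⁻¹ + ((1 - x) ^ 2)⁻¹)) := by
        gcongr

/-- The derivative of the smooth step is continuous. [folklore] -/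
theorem continuous_deriv_smoothTransition : Continuous (deriv smoothTransition) :=
  (smoothTransition.contDiff (n := 1)).continuous_deriv le_rfl

/-- On every compact window `[δ, 1 - δ]`, `0 < δ ≤ 1/2`, the derivative of the smooth step is
bounded below by a positive constant. [folklore] -/
theorem exists_pos_le_deriv_smoothTransition {δ : ℝ} (hδ0 : 0 < δ) (hδ : δ ≤ 1 / 2) :
    ∃ c : ℝ, 0 < c ∧ ∀ u ∈ Icc δ (1 - δ), c ≤ deriv smoothTransition u := by
  have hne : (Icc δ (1 - δ)).Nonempty := nonempty_Icc.2 (by linarith)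
  obtain ⟨u₀, hu₀, hmin⟩ :=
    isCompact_Icc.exists_isMinOn hne continuous_deriv_smoothTransition.continuousOn
  refine ⟨deriv smoothTransition u₀, deriv_smoothTransition_pos (by linarith [hu₀.1])
    (by linarith [hu₀.2]), fun u hu ↦ hmin hu⟩

/-! ## A fast smooth-step phase against a slow target -/

/-- **Fast phase, slow target.**  Let `0 < w`, `0 < m₀`, `0 ≤ M`.  There is `k₁` such that for all
`k ≥ k₁` and every `g` with `|g'| ≤ M` on `[-w, w]` staying `m₀`-away from `2πℤ` there, at every
solution `x ∈ [-w, w]` of `2πk S((x + w)/2w) + g x ∈ 2πℤ` the phase is transversally increasing: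
`2πk S'((x + w)/2w)/(2w) + g' x > 0`.  (Where the step is fast its slope beats `M`; where it is
slow — near the ends — the flat-end estimates show `2πk S` resp. `2πk (1 - S)` is below `m₀`, so
there is no solution there at all.) [folklore] -/
theorem smoothTransition_fastPhase {w m₀ M : ℝ} (hw : 0 < w) (hm₀ : 0 < m₀) (hM : 0 ≤ M) :
    ∃ k₁ : ℕ, ∀ k : ℕ, k₁ ≤ k → ∀ g g' : ℝ → ℝ,
      (∀ x ∈ Icc (-w) w, |g' x| ≤ M) →
      (∀ x ∈ Icc (-w) w, ∀ n : ℤ, m₀ ≤ |g x - 2 * π * n|) →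
      ∀ x ∈ Icc (-w) w,
        (∃ n : ℤ, 2 * π * k * smoothTransition ((x + w) / (2 * w)) + g x = 2 * π * n) →
        0 < 2 * π * k * deriv smoothTransition ((x + w) / (2 * w)) / (2 * w) + g' x := by
  -- the window `[δ, 1 - δ]` outside which the step is slow AND flat enough
  set δ : ℝ := min (1 / 2) (m₀ / (2 * w * M + m₀)) with hδ
  have hδ0 : 0 < δ := lt_min (by norm_num) (div_pos hm₀ (by positivity))
  have hδ2 : δ ≤ 1 / 2 := min_le_left _ _
  have hδm : 2 * w * M * δ < m₀ := by
    have h1 : δ ≤ m₀ / (2 * w * M + m₀) := min_le_right _ _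
    have h2 : 2 * w * M * (m₀ / (2 * w * M + m₀)) < m₀ := by
      rw [mul_div_assoc']
      rw [div_lt_iff₀ (by positivity)]
      nlinarith [mul_nonneg (mul_nonneg (by norm_num : (0 : ℝ) ≤ 2) hw.le) hM]
    calc 2 * w * M * δ ≤ 2 * w * M * (m₀ / (2 * w * M + m₀)) := by gcongr
      _ < m₀ := h2
  have hflat : 4 * w * M * δ ^ 2 < m₀ := by
    have : δ ^ 2 ≤ δ * (1 / 2) := by rw [sq]; gcongr
    nlinarith [mul_nonneg (mul_nonneg (by norm_num : (0 : ℝ) ≤ 4) hw.le) hM]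
  obtain ⟨c, hc, hcle⟩ := exists_pos_le_deriv_smoothTransition hδ0 hδ2
  -- `k₁` with `2π k₁ c / (2w) > M`
  obtain ⟨k₀, hk₀⟩ := exists_nat_gt (w * M / (π * c))
  refine ⟨k₀, fun k hk g g' hg' hg x hx hsol ↦ ?_⟩
  obtain ⟨n, hn⟩ := hsol
  have hkpos : (0 : ℝ) < k := by
    have : (k₀ : ℝ) ≤ k := by exact_mod_cast hk
    have h0 : 0 ≤ w * M / (π * c) := by positivity
    linarith
  set u : ℝ := (x + w) / (2 * w) with hu
  have hu0 : 0 ≤ u := div_nonneg (by linarith [hx.1]) (by positivity)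
  have hu1 : u ≤ 1 := (div_le_one (by positivity)).2 (by linarith [hx.2])
  have hgx := hg' x hx
  have hg'lo : -M ≤ g' x := (abs_le.1 hgx).1
  set D : ℝ := 2 * π * k * deriv smoothTransition u / (2 * w) with hD
  -- fast case: `D > M` settles it
  by_cases hfast : M < D
  · linarith
  push Not at hfast
  exfalso
  have hDS : 2 * π * k * deriv smoothTransition u = 2 * w * D := by
    rw [hD]; field_simp
  -- the middle window is fast, so we are near an end
  have hnotmid : u ∉ Icc δ (1 - δ) := by
    intro hmem
    have h1 : c ≤ deriv smoothTransition u := hcle u hmem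
    have h2 : w * M / (π * c) < k := lt_of_lt_of_le hk₀ (by exact_mod_cast hk)
    rw [div_lt_iff₀ (by positivity)] at h2
    have h3 : 2 * π * k * c / (2 * w) ≤ D := by
      rw [hD]; gcongr
    have h4 : M < 2 * π * k * c / (2 * w) := by
      rw [lt_div_iff₀ (by positivity)]; nlinarith
    linarith
  rw [mem_Icc, not_and_or, not_le, not_le] at hnotmid
  rcases hnotmid with hlt | hgt
  · -- left end: `2πk S(u) < m₀`, contradicting the distance of `g x` to `2πn`
    have hsmall : 2 * π * k * smoothTransition u < m₀ := by
      rcases hu0.eq_or_lt with h0 | h0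
      · rw [← h0, smoothTransition.zero, mul_zero]; exact hm₀
      · have h1 := smoothTransition_le_sq_mul_deriv h0 (by linarith)
        calc 2 * π * k * smoothTransition u
            ≤ 2 * π * k * (2 * u ^ 2 * deriv smoothTransition u) := by gcongr
          _ = 2 * u ^ 2 * (2 * w * D) := by rw [← hDS]; ring
          _ ≤ 2 * u ^ 2 * (2 * w * M) := by gcongr
          _ = 4 * w * M * u ^ 2 := by ring
          _ ≤ 4 * w * M * δ ^ 2 := by
              gcongr
          _ < m₀ := hflat
    have hnn : 0 ≤ 2 * π * k * smoothTransition u := by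
      have := smoothTransition.nonneg u; positivity
    have hdist := hg x hx n
    have heq : g x - 2 * π * n = -(2 * π * k * smoothTransition u) := by linarith
    rw [heq, abs_neg, abs_of_nonneg hnn] at hdist
    linarith
  · -- right end: `2πk (1 - S u) < m₀`, contradicting the distance of `g x` to `2π(n - k)`
    have hsmall : 2 * π * k * (1 - smoothTransition u) < m₀ := by
      rcases hu1.eq_or_lt with h1 | h1
      · rw [h1, smoothTransition.one, sub_self, mul_zero]; exact hm₀
      · have h2 := one_sub_smoothTransition_le_sq_mul_deriv (by linarith) h1
        calc 2 * π * k * (1 - smoothTransition u)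
            ≤ 2 * π * k * (2 * (1 - u) ^ 2 * deriv smoothTransition u) := by gcongr
          _ = 2 * (1 - u) ^ 2 * (2 * w * D) := by rw [← hDS]; ring
          _ ≤ 2 * (1 - u) ^ 2 * (2 * w * M) := by gcongr
          _ = 4 * w * M * (1 - u) ^ 2 := by ring
          _ ≤ 4 * w * M * δ ^ 2 := by
              have : 1 - u < δ := by linarith
              have h0 : 0 ≤ 1 - u := by linarith
              gcongr
          _ < m₀ := hflat
    have hnn : 0 ≤ 2 * π * k * (1 - smoothTransition u) := by
      have := smoothTransition.le_one u
      have : 0 ≤ 1 - smoothTransition u := by linarith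
      positivity
    have hdist := hg x hx (n - k)
    have heq : g x - 2 * π * ((n - k : ℤ) : ℝ) = 2 * π * k * (1 - smoothTransition u) := by
      push_cast; linarith
    rw [heq, abs_of_nonneg hnn] at hdist
    linarith

/-- **Fast-or-flat trichotomy** (the pointwise core of `smoothTransition_fastPhase`).  Let
`0 < w`, `0 < m₀`, `0 ≤ M`.  There is `k₁` such that for all `k ≥ k₁` and every `u ∈ [0, 1]`
either the phase `2πk S` is FAST at `u` (slope `2πk S'(u)/(2w) > M`), or it is within `m₀` of
`0`, or within `m₀` of the full turn `2πk`. [folklore] -/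
theorem smoothTransition_fast_or_flat {w m₀ M : ℝ} (hw : 0 < w) (hm₀ : 0 < m₀) (hM : 0 ≤ M) :
    ∃ k₁ : ℕ, ∀ k : ℕ, k₁ ≤ k → ∀ u ∈ Icc (0 : ℝ) 1,
      M < 2 * π * k * deriv smoothTransition u / (2 * w) ∨
        2 * π * k * smoothTransition u < m₀ ∨ 2 * π * k * (1 - smoothTransition u) < m₀ := by
  -- the window `[δ, 1 - δ]` outside which a slow step is also flat
  set δ : ℝ := min (1 / 2) (m₀ / (2 * w * M + m₀)) with hδ
  have hδ0 : 0 < δ := lt_min (by norm_num) (div_pos hm₀ (by positivity))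
  have hδ2 : δ ≤ 1 / 2 := min_le_left _ _
  have hδm : 2 * w * M * δ < m₀ := by
    have h1 : δ ≤ m₀ / (2 * w * M + m₀) := min_le_right _ _
    have h2 : 2 * w * M * (m₀ / (2 * w * M + m₀)) < m₀ := by
      rw [mul_div_assoc', div_lt_iff₀ (by positivity)]
      nlinarith [mul_nonneg (mul_nonneg (by norm_num : (0 : ℝ) ≤ 2) hw.le) hM]
    calc 2 * w * M * δ ≤ 2 * w * M * (m₀ / (2 * w * M + m₀)) := by gcongr
      _ < m₀ := h2
  have hflat : 4 * w * M * δ ^ 2 < m₀ := by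
    have : δ ^ 2 ≤ δ * (1 / 2) := by rw [sq]; gcongr
    nlinarith [mul_nonneg (mul_nonneg (by norm_num : (0 : ℝ) ≤ 4) hw.le) hM]
  obtain ⟨c, hc, hcle⟩ := exists_pos_le_deriv_smoothTransition hδ0 hδ2
  obtain ⟨k₀, hk₀⟩ := exists_nat_gt (w * M / (π * c))
  refine ⟨k₀, fun k hk u hu ↦ ?_⟩
  set D : ℝ := 2 * π * k * deriv smoothTransition u / (2 * w) with hD
  by_cases hfast : M < D
  · exact Or.inl hfast
  push Not at hfast
  right
  have hDS : 2 * π * k * deriv smoothTransition u = 2 * w * D := by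
    rw [hD]; field_simp
  have hnotmid : u ∉ Icc δ (1 - δ) := by
    intro hmem
    have h1 : c ≤ deriv smoothTransition u := hcle u hmem
    have h2 : w * M / (π * c) < k := lt_of_lt_of_le hk₀ (by exact_mod_cast hk)
    rw [div_lt_iff₀ (by positivity)] at h2
    have h3 : 2 * π * k * c / (2 * w) ≤ D := by
      rw [hD]; gcongr
    have h4 : M < 2 * π * k * c / (2 * w) := by
      rw [lt_div_iff₀ (by positivity)]; nlinarith
    linarith
  rw [mem_Icc, not_and_or, not_le, not_le] at hnotmid
  rcases hnotmid with hlt | hgt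
  · left
    rcases hu.1.eq_or_lt with h0 | h0
    · rw [← h0, smoothTransition.zero, mul_zero]; exact hm₀
    · have h1 := smoothTransition_le_sq_mul_deriv h0 (by linarith)
      calc 2 * π * k * smoothTransition u
          ≤ 2 * π * k * (2 * u ^ 2 * deriv smoothTransition u) := by gcongr
        _ = 2 * u ^ 2 * (2 * w * D) := by rw [← hDS]; ring
        _ ≤ 2 * u ^ 2 * (2 * w * M) := by gcongr
        _ = 4 * w * M * u ^ 2 := by ring
        _ ≤ 4 * w * M * δ ^ 2 := by gcongr
        _ < m₀ := hflat
  · right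
    rcases hu.2.eq_or_lt with h1 | h1
    · rw [h1, smoothTransition.one, sub_self, mul_zero]; exact hm₀
    · have h2 := one_sub_smoothTransition_le_sq_mul_deriv (by linarith) h1
      calc 2 * π * k * (1 - smoothTransition u)
          ≤ 2 * π * k * (2 * (1 - u) ^ 2 * deriv smoothTransition u) := by gcongr
        _ = 2 * (1 - u) ^ 2 * (2 * w * D) := by rw [← hDS]; ring
        _ ≤ 2 * (1 - u) ^ 2 * (2 * w * M) := by gcongr
        _ = 4 * w * M * (1 - u) ^ 2 := by ring
        _ ≤ 4 * w * M * δ ^ 2 := by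
            have : 1 - u < δ := by linarith
            have h0 : 0 ≤ 1 - u := by linarith
            gcongr
        _ < m₀ := hflat

end Literature.Topology.FourManifolds

end
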